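import Literature.AlgebraicGeometry.ShimuraVarieties.UnitaryBallPeriodLattice
import Literature.AlgebraicGeometry.ShimuraVarieties.UnitaryBallLevelFiniteCover
import Literature.Analysis.Complex.RealPartMaximumPrinciple
import Literature.Algebra.Module.ZLatticeOfFGRankLeSpan
import Literature.AlgebraicGeometry.HodgeTheory.JacobianHodgeGenus
import Literature.AlgebraicGeometry.HodgeTheory.HodgeTypeConjugation
import Literature.AlgebraicGeometry.HodgeTheory.HodgeTypeProjectors
import Literature.AlgebraicGeometry.HodgeTheory.HypersurfaceHolomorphicForms
import Mathlib.LinearAlgebra.Dual.Lemmas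
import HarnessLib

/-!
# The period group of a compact ball quotient is a full lattice in `ℂ^q`, `q = h^{1,0}`

Layer `Literature/AlgebraicGeometry/ShimuraVarieties`, sequel of `UnitaryBallPeriodLattice` (the period
group `Λ = D.periodLattice A 𝔣 b ⊆ ℂ^ι` of the holomorphic `1`-forms of the compact ball quotient
`X(ℂ) = Γ \ 𝔹²` in a basis `b : Basis ι ℂ Ω¹(X^an)`; finitely generated, free, of rank `≤ b₁(X)`).
THEOREMS ONLY (no definition, no named fact).  The two inputs of Griffiths–Harris' "the periods form a
lattice in `H⁰(X, Ω¹)^*`" (Ch. 2 §6) / Voisin I §12.1.2 that were missing: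

* `eq_zero_of_forall_re_period_eq_zero` — **a holomorphic `1`-form all of whose periods are purely
  imaginary vanishes**: the real part of the holomorphic primitive `P` of `ψ^* α` on the ball is then
  `Γ`-invariant (`primitive_formPullback₁_smul_eq_add_period`), i.e. constant on the fibres of the open
  surjection `ψ : 𝔹² → X^an` onto a COMPACT manifold, so `P` is constant by the maximum principle for real
  parts (`Literature.Analysis.Complex.exists_eqOn_const_of_re_fibre_constant`), `dP = ψ^* α = 0` on the
  ball, and `α = 0` (`formPullback₁_eq_zero_iff`); likewise for imaginary parts and for all periods zero;
* `realLinear_apply_eq_sum_re` — every `ℝ`-linear functional `ℓ` on `ℂ^ι` is `v ↦ Σᵢ Re(aᵢ vᵢ)` with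
  `aᵢ = ℓ(eᵢ) − i ℓ(i eᵢ)`;
* **`span_real_periodLattice_eq_top` — `Λ` spans `ℂ^ι` over `ℝ`**: a real functional killing `Λ` is
  `v ↦ Re Σ aᵢ vᵢ`, and `Re Σ aᵢ c_{bᵢ}(γ) = Re c_α(γ)` for `α = Σ aᵢ bᵢ`, so `α = 0`, `a = 0`, `ℓ = 0`;
* `finrank_bettiCohomology_one_eq_two_mul_card` — **`b₁(X) = 2 |ι| = 2 h^{1,0}(X)`** (Voisin I Cor. 6.14
  with Cor. 7.6: `b₁ = 2 dim H^{1,0}` and `Ω¹(X^an) ≅ H^{1,0}`; tree: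
  `finrank_bettiCohomology_one_eq_two_mul_finrank_hodgeOneZero`, `ratPieceOneEquivFormsSurface`,
  `isOfHodgeType_iff_mem_hodgePQ`);
* **`finrank_periodLattice_eq` — `rank_ℤ Λ = 2 |ι| = dim_ℝ ℂ^ι`** and **`exists_periodMatrix` — a
  period matrix**: a continuous real-linear isomorphism `Φ : ℝ^{2q} ≃ ℂ^ι` with `Φ(ℤ^{2q}) = Λ`
  (`Literature.Algebra.Module` lattice criterion `AddSubgroup.exists_continuousLinearEquiv_of_fg_of_finrank_le`
  from `rank ≤ dim` and `span = ⊤`), i.e. `Λ` is a full lattice and `ℂ^ι / Λ` is a complex torus of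
  dimension `q = h^{1,0}(X)` — the Albanese torus of `X` (Griffiths–Harris Ch. 2 §6).

## References

* [GriffithsHarris1978] P. Griffiths, J. Harris, *Principles of Algebraic Geometry* (1978), Ch. 2 §6.
* [VoisinHodgeI2002] C. Voisin, *Hodge Theory and Complex Algebraic Geometry I* (2002), §6.1.3 Cor. 6.14,
  §7.1.1 Cor. 7.6, §12.1.2.
* [NeukirchANT1999] J. Neukirch, *Algebraic Number Theory* (1999), Ch. I §4 Prop. (4.2) (lattices).
-/

noncomputable section

open Matrix MulAction Function Set Filter Module Complex
open scoped Manifold Topology TensorProduct ComplexConjugate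
open Literature.Geometry.ComplexHyperbolic
open Literature.Geometry.ComplexHyperbolic.BallModel (U21 Ball Jac x₀ nsq actVec)
open Literature.Geometry.Kaehler (MForm IsHolomorphicInCharts holFormsInCharts isOfType_of_mem
  isHolomorphicInCharts_of_mem isSmoothForm_of_mem)
open Literature.NumberTheory.Transcendental
open Literature.NumberTheory.Automorphic.AutomorphyFactor
open Literature.AlgebraicGeometry.HodgeTheory
open Literature.AlgebraicGeometry.Motives (bettiCohomology)
open Literature.AlgebraicTopology.SingularHomology
open Literature.Analysis.Complex

namespace Literature.AlgebraicGeometry.ShimuraVarieties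

/-! ### Ball calculus: a form with vanishing `formCLM` vanishes -/

namespace BallForms

/-- If the field of `ℂ`-linear forms `Σᵢ Fᵢ(z) dzᵢ` vanishes at a ball point then so does the coefficient
vector `F(z)` (evaluate on the basis vectors). [cite: Borel1997, §5.14] -/
theorem eq_zero_of_formCLM_eq_zero (F : Ball → (Fin 2 → ℂ)) (z : Ball) (h : formCLM F z.1 = 0) :
    F z = 0 := by
  funext i
  have hi := congrArg (fun φ : (Fin 2 → ℂ) →L[ℂ] ℂ ↦ φ (Pi.single i 1)) h
  simp only [formCLM_apply, extend_apply_coe, _root_.zero_apply] at hi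
  fin_cases i <;> simpa [Fin.sum_univ_two] using hi

end BallForms

namespace UnitaryBallUniformisationDatum

variable {X : Motives.SchemeOver ℂ} (D : UnitaryBallUniformisationDatum 2 X) (A : HodgeModel 2 X)
  (𝔣 : D.SylvesterFrame)

/-! ### A holomorphic `1`-form with purely imaginary (or purely real, or zero) periods vanishes -/

/-- The uniformisation `ψ : ℂ² ⊇ 𝔹² → X^an` restricted to the ball is an open map (it is the open map
`ballUnifMap` followed by the homeomorphism `X^an ≃ₜ X(ℂ)`). [cite: BergeronMillsonMoeglin2016Balls, Introduction §1.1] -/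
theorem isOpenMap_restrict_modelUnif :
    IsOpenMap (BallForms.ballSet.restrict (D.modelUnif A 𝔣)) :=
  A.isAnalytification.homeomorph.symm.isOpenMap.comp (D.isOpenMap_ballUnifMap 𝔣)

/-- `ψ` maps the ball onto `X^an`. [cite: BergeronMillsonMoeglin2016Balls, Introduction §1.1] -/
theorem surjOn_modelUnif : SurjOn (D.modelUnif A 𝔣) BallForms.ballSet univ := fun x _ ↦ by
  obtain ⟨z, hz⟩ := D.exists_modelUnif_eq A 𝔣 x
  exact ⟨z.1, z.2, hz⟩

/-- The ball is preconnected (star-shaped). [cite: Spivak1965, Thm. 4-11] -/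
theorem isPreconnected_ballSet : IsPreconnected BallForms.ballSet :=
  (BallForms.starConvex_zero_ballSet.isPathConnected
    (show nsq (0 : Fin 2 → ℂ) < 1 by simp [BallModel.nsq])).isConnected.isPreconnected

variable {D A 𝔣}

/-- **A holomorphic `1`-form whose periods on `Γ` are purely imaginary vanishes.**  With `F = ψ^* α` and
`P` its holomorphic primitive on the ball, `Re P(γ z) = Re P(z) + Re c_α(γ) = Re P(z)`: `Re P` is constant
on the fibres of the open surjection `ψ : 𝔹² → X^an` onto the compact `X^an`, so `P` is constant
(`exists_eqOn_const_of_re_fibre_constant`, the maximum principle for real parts), `dP = Σ Fᵢ dzᵢ = 0`,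
`F = 0`, `α = 0` (`formPullback₁_eq_zero_iff`). [cite: GriffithsHarris1978, Ch. 2 §6] [cite: VoisinHodgeI2002, §12.1.2] -/
theorem eq_zero_of_forall_re_period_eq_zero (α : holFormsInCharts A.model A.carrier 1)
    (h : ∀ γ : D.Γ, (BallForms.period (D.formPullback₁ A 𝔣 (α : MForm 𝓘(ℝ, A.model) A.carrier ℂ 1))
      (D.ballRep 𝔣 γ)).re = 0) : α = 0 := by
  haveI := A.compactSpace_carrier D.isSmoothProjective
  set F := D.formPullback₁ A 𝔣 (α : MForm 𝓘(ℝ, A.model) A.carrier ℂ 1) with hF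
  have hFh := D.formPullback₁_coe_mem_holomorphic A 𝔣 α
  have hFc := isClosedForm_formPullback₁_of_mem (D := D) (A := A) (𝔣 := 𝔣) α
  set P : (Fin 2 → ℂ) → ℂ := BallForms.extend ℂ (BallForms.primitive F) with hP
  have hPd : DifferentiableOn ℂ P BallForms.ballSet :=
    BallForms.mem_holomorphic_iff.1 (BallForms.primitive_mem_holomorphic hFh hFc)
  have hfib : ∀ z ∈ BallForms.ballSet, ∀ w ∈ BallForms.ballSet,
      D.modelUnif A 𝔣 z = D.modelUnif A 𝔣 w → (P z).re = (P w).re := by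
    intro z hz w hw he
    obtain ⟨γ, hγ⟩ := (D.modelUnif_eq_iff A 𝔣 ⟨z, hz⟩ ⟨w, hw⟩).1 he
    have ez : P z = BallForms.primitive F ⟨z, hz⟩ := BallForms.extend_apply_coe _ ⟨z, hz⟩
    have ew : P w = BallForms.primitive F ⟨w, hw⟩ := BallForms.extend_apply_coe _ ⟨w, hw⟩
    rw [ez, ew, ← hγ, D.primitive_formPullback₁_smul_eq_add_period A 𝔣 α γ ⟨z, hz⟩, Complex.add_re, h γ,
      add_zero]
  obtain ⟨a, ha⟩ := exists_eqOn_const_of_re_fibre_constant BallForms.isOpen_ballSet isPreconnected_ballSet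
    (D.isOpenMap_restrict_modelUnif A 𝔣) (D.surjOn_modelUnif A 𝔣) hPd hfib
  -- `dP = 0` on the ball, hence `F = 0`
  have hF0 : F = 0 := by
    funext z
    have h1 : HasFDerivAt P (BallForms.formCLM F z.1) z.1 := BallForms.hasFDerivAt_extend_primitive hFh hFc z
    have h2 : HasFDerivAt P (0 : (Fin 2 → ℂ) →L[ℂ] ℂ) z.1 := by
      have hev : P =ᶠ[𝓝 z.1] fun _ ↦ a :=
        Filter.eventually_of_mem (BallForms.isOpen_ballSet.mem_nhds (BallForms.coe_mem_ballSet z))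
          fun w hw ↦ ha hw
      exact (hasFDerivAt_const a z.1).congr_of_eventuallyEq hev
    have h0 : BallForms.formCLM F z.1 = 0 := h1.unique h2
    simpa using BallForms.eq_zero_of_formCLM_eq_zero F z h0
  have hα : (α : MForm 𝓘(ℝ, A.model) A.carrier ℂ 1) = 0 :=
    (formPullback₁_eq_zero_iff (D := D) (A := A) (𝔣 := 𝔣) (isOfType_of_mem α)).1 hF0
  exact Subtype.ext hα

/-- **A holomorphic `1`-form whose periods on `Γ` are real vanishes** (apply the previous statement to
`i α`). [cite: GriffithsHarris1978, Ch. 2 §6] -/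
theorem eq_zero_of_forall_im_period_eq_zero (α : holFormsInCharts A.model A.carrier 1)
    (h : ∀ γ : D.Γ, (BallForms.period (D.formPullback₁ A 𝔣 (α : MForm 𝓘(ℝ, A.model) A.carrier ℂ 1))
      (D.ballRep 𝔣 γ)).im = 0) : α = 0 := by
  have hI : (I • α : holFormsInCharts A.model A.carrier 1) = 0 := by
    refine eq_zero_of_forall_re_period_eq_zero (D := D) (A := A) (𝔣 := 𝔣) (I • α) fun γ ↦ ?_
    rw [D.period_formPullback₁_smul A 𝔣 α I, Complex.I_mul_re, h γ, neg_zero]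
  simpa [smul_eq_zero, Complex.I_ne_zero] using hI

/-- **A holomorphic `1`-form with vanishing periods on `Γ` vanishes** (there are no exact holomorphic
`1`-forms on a compact surface but `0`). [cite: GriffithsHarris1978, Ch. 2 §6] [cite: VoisinHodgeI2002, §12.1.2] -/
theorem eq_zero_of_forall_period_eq_zero (α : holFormsInCharts A.model A.carrier 1)
    (h : ∀ γ : D.Γ, BallForms.period (D.formPullback₁ A 𝔣 (α : MForm 𝓘(ℝ, A.model) A.carrier ℂ 1))
      (D.ballRep 𝔣 γ) = 0) : α = 0 :=
  eq_zero_of_forall_re_period_eq_zero (D := D) (A := A) (𝔣 := 𝔣) α fun γ ↦ by rw [h γ, Complex.zero_re]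

/-! ### Real linear functionals on `ℂ^ι` -/

/-- A vector of `ℂ^ι` as a real combination of the vectors `eᵢ` and `i eᵢ`. [cite: GriffithsHarris1978, Ch. 2 §6] -/
theorem eq_sum_re_smul_single_add_im_smul_single {ι : Type} [Fintype ι] [DecidableEq ι] (v : ι → ℂ) :
    v = ∑ i, ((v i).re • (Pi.single i 1 : ι → ℂ) + (v i).im • (Pi.single i I : ι → ℂ)) := by
  funext j
  simp only [Finset.sum_apply, Pi.add_apply, Pi.smul_apply, Pi.single_apply]
  rw [Finset.sum_eq_single j]
  · simp only [if_true]
    rw [Complex.real_smul, Complex.real_smul, mul_one]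
    exact (Complex.re_add_im (v j)).symm
  · intro i _ hij
    simp [Ne.symm hij]
  · intro hj
    exact (hj (Finset.mem_univ j)).elim

/-- **Every real linear functional on `ℂ^ι` is `v ↦ Σᵢ Re(aᵢ vᵢ)`** with `aᵢ = ℓ(eᵢ) − i ℓ(i eᵢ)`.
[cite: GriffithsHarris1978, Ch. 2 §6] -/
theorem realLinear_apply_eq_sum_re {ι : Type} [Fintype ι] [DecidableEq ι] (ℓ : (ι → ℂ) →ₗ[ℝ] ℝ)
    (v : ι → ℂ) :
    ℓ v = ∑ i, (((ℓ (Pi.single i 1) : ℂ) - I * ℓ (Pi.single i I)) * v i).re := by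
  conv_lhs => rw [eq_sum_re_smul_single_add_im_smul_single v]
  rw [map_sum]
  refine Finset.sum_congr rfl fun i _ ↦ ?_
  rw [map_add, map_smul, map_smul, smul_eq_mul, smul_eq_mul]
  simp only [Complex.mul_re, Complex.sub_re, Complex.ofReal_re, Complex.mul_im, Complex.I_re,
    Complex.ofReal_im, Complex.I_im, Complex.sub_im, zero_mul, mul_zero, sub_zero, one_mul, zero_sub,
    zero_add]
  ring

variable (D A 𝔣) {ι : Type} (b : Basis ι ℂ (holFormsInCharts A.model A.carrier 1))

/-- The period along `g` is a `ℂ`-linear functional of the form. [cite: GriffithsHarris1978, Ch. 2 §6] -/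
theorem exists_linearMap_period (g : U21) :
    ∃ L : holFormsInCharts A.model A.carrier 1 →ₗ[ℂ] ℂ, ∀ α,
      L α = BallForms.period (D.formPullback₁ A 𝔣 (α : MForm 𝓘(ℝ, A.model) A.carrier ℂ 1)) g :=
  ⟨{ toFun := fun α ↦ BallForms.period (D.formPullback₁ A 𝔣 (α : MForm 𝓘(ℝ, A.model) A.carrier ℂ 1)) g
     map_add' := fun α β ↦ D.period_formPullback₁_add A 𝔣 α β g
     map_smul' := fun a α ↦ by rw [D.period_formPullback₁_smul A 𝔣 α a g, smul_eq_mul, RingHom.id_apply] },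
    fun _ ↦ rfl⟩

/-- **Periods of a combination of basis forms**: `c_{Σ aᵢ bᵢ}(γ) = Σ aᵢ c_{bᵢ}(γ) = Σ aᵢ λ(γ)ᵢ`.
[cite: GriffithsHarris1978, Ch. 2 §6] -/
theorem period_sum_smul_basis [Fintype ι] (a : ι → ℂ) (γ : D.Γ) :
    BallForms.period (D.formPullback₁ A 𝔣 ((∑ i, a i • b i : holFormsInCharts A.model A.carrier 1) :
        MForm 𝓘(ℝ, A.model) A.carrier ℂ 1)) (D.ballRep 𝔣 γ) =
      ∑ i, a i * D.periodVec A 𝔣 b γ i := by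
  obtain ⟨L, hL⟩ := D.exists_linearMap_period A 𝔣 (D.ballRep 𝔣 γ)
  rw [← hL, map_sum]
  refine Finset.sum_congr rfl fun i _ ↦ ?_
  rw [map_smul, smul_eq_mul, hL, periodVec_apply]

/-! ### `Λ` spans `ℂ^ι` over `ℝ` -/

/-- **The period group spans `ℂ^ι` over `ℝ`.** Otherwise a non-zero real functional `ℓ` kills `Λ`;
writing `ℓ(v) = Σ Re(aᵢ vᵢ)` (`realLinear_apply_eq_sum_re`), `0 = ℓ(λ(γ)) = Re c_α(γ)` for `α = Σ aᵢ bᵢ`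
and all `γ ∈ Γ`, so `α = 0` (`eq_zero_of_forall_re_period_eq_zero`), `a = 0` (`b` is a basis) and `ℓ = 0`.
[cite: GriffithsHarris1978, Ch. 2 §6] [cite: VoisinHodgeI2002, §12.1.2] -/
theorem span_real_periodLattice_eq_top [Fintype ι] :
    Submodule.span ℝ (D.periodLattice A 𝔣 b : Set (ι → ℂ)) = ⊤ := by
  classical
  by_contra hne
  obtain ⟨ℓ, hℓ0, hℓ⟩ := Submodule.exists_dual_map_eq_bot_of_lt_top (lt_top_iff_ne_top.2 hne) inferInstance
  have hker : ∀ v ∈ Submodule.span ℝ (D.periodLattice A 𝔣 b : Set (ι → ℂ)), ℓ v = 0 :=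
    fun v hv ↦ (Submodule.eq_bot_iff _).1 hℓ _ (Submodule.mem_map_of_mem hv)
  set a : ι → ℂ := fun i ↦ (ℓ (Pi.single i 1) : ℂ) - I * ℓ (Pi.single i I) with ha
  set α : holFormsInCharts A.model A.carrier 1 := ∑ i, a i • b i with hαdef
  -- all real parts of the periods of `α` vanish
  have hre : ∀ γ : D.Γ, (BallForms.period (D.formPullback₁ A 𝔣
      (α : MForm 𝓘(ℝ, A.model) A.carrier ℂ 1)) (D.ballRep 𝔣 γ)).re = 0 := by
    intro γ
    rw [hαdef, D.period_sum_smul_basis A 𝔣 b a γ, Complex.re_sum, ← realLinear_apply_eq_sum_re ℓ]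
    exact hker _ (Submodule.subset_span (D.periodVec_mem_periodLattice A 𝔣 b γ))
  have hα0 : α = 0 := eq_zero_of_forall_re_period_eq_zero (D := D) (A := A) (𝔣 := 𝔣) α hre
  have ha0 : ∀ i, a i = 0 := by
    have hli := (Fintype.linearIndependent_iff.1 b.linearIndependent) a (by rw [← hαdef]; exact hα0)
    exact hli
  -- hence `ℓ = 0`
  refine hℓ0 (LinearMap.ext fun v ↦ ?_)
  rw [realLinear_apply_eq_sum_re ℓ v, LinearMap.zero_apply]
  refine Finset.sum_eq_zero fun i _ ↦ ?_
  have : (ℓ (Pi.single i 1) : ℂ) - I * ℓ (Pi.single i I) = 0 := ha0 i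
  rw [this, zero_mul, Complex.zero_re]

/-! ### `b₁(X) = 2 h^{1,0}(X) = 2 |ι|` -/

/-- **`dim_ℂ Ω¹(X^an) = h^{1,0}(X)`** read against the tree's `hodgeOneZero`: for any Hodge model `A`
of the smooth projective surface `X`, `dim_ℂ holFormsInCharts = dim_ℂ hodgeOneZero` (`Ω¹ ≅ Θ_A⁻¹(H^{1,0})`,
Voisin I Cor. 7.6, tree `ratPieceOneEquivFormsSurface`; the type `(1,0)` is read in any model,
`isOfHodgeType_iff_mem_hodgePQ`). [cite: VoisinHodgeI2002, §7.1.1 Cor. 7.6] -/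
theorem finrank_holFormsInCharts_eq_finrank_hodgeOneZero :
    Module.finrank ℂ (holFormsInCharts A.model A.carrier 1) =
      Module.finrank ℂ (hodgeOneZero D.isSmoothProjective) := by
  have hX := D.isSmoothProjective
  have h1 : Module.finrank ℂ (holFormsInCharts A.model A.carrier 1) =
      Module.finrank ℂ (A.ratPiece hX 1 1 0) :=
    (A.ratPieceOneEquivFormsSurface hX).finrank_eq.symm
  have h2 : Module.finrank ℂ (A.ratPiece hX 1 1 0) = Module.finrank ℂ (A.hodgePQ 1 1 0) := by
    rw [HodgeModel.ratPiece, Submodule.comap_equiv_eq_map_symm, LinearEquiv.finrank_map_eq]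
  have h3 : hodgeOneZero hX =
      A.typePiece 1 ⟨(1, 0), Finset.HasAntidiagonal.mem_antidiagonal.2 rfl⟩ := by
    ext c
    rw [mem_hodgeOneZero, HodgeModel.mem_typePiece_iff, isOfHodgeType_iff_mem_hodgePQ hX A]
  have h4 : Module.finrank ℂ (hodgeOneZero hX) = Module.finrank ℂ (A.hodgePQ 1 1 0) := by
    rw [h3, HodgeModel.typePiece, Submodule.comap_equiv_eq_map_symm, LinearEquiv.finrank_map_eq]
  rw [h1, h2, h4]

include D A b in
/-- **`b₁(X) = 2 |ι|`** for a basis `b : Basis ι ℂ Ω¹(X^an)`: `b₁ = 2 h^{1,0}` (Voisin I Cor. 6.14) and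
`h^{1,0} = dim Ω¹ = |ι|`. [cite: VoisinHodgeI2002, §6.1.3 Cor. 6.14 and §7.1.1 Cor. 7.6] -/
theorem finrank_bettiCohomology_one_eq_two_mul_card [Fintype ι] :
    Module.finrank ℚ (bettiCohomology X 1) = 2 * Fintype.card ι := by
  rw [finrank_bettiCohomology_one_eq_two_mul_finrank_hodgeOneZero D.isSmoothProjective,
    ← D.finrank_holFormsInCharts_eq_finrank_hodgeOneZero A, Module.finrank_eq_card_basis b]

/-- `dim_ℝ ℂ^ι = 2 |ι|`. [cite: GriffithsHarris1978, Ch. 2 §6] -/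
theorem finrank_real_pi_complex (ι : Type) [Fintype ι] : Module.finrank ℝ (ι → ℂ) = 2 * Fintype.card ι := by
  rw [Module.finrank_pi_fintype ℝ, Finset.sum_const, Finset.card_univ, Complex.finrank_real_complex,
    smul_eq_mul, mul_comm]

/-! ### The period group is a full lattice -/

/-- **`rank_ℤ Λ ≤ dim_ℝ ℂ^ι`** (`rank Λ ≤ b₁ = 2|ι|`). [cite: GriffithsHarris1978, Ch. 2 §6] -/
theorem finrank_periodLattice_le_finrank_real [Fintype ι] :
    Module.finrank ℤ (D.periodLattice A 𝔣 b) ≤ Module.finrank ℝ (ι → ℂ) := by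
  rw [finrank_real_pi_complex, ← D.finrank_bettiCohomology_one_eq_two_mul_card A b]
  exact D.finrank_periodLattice_le A 𝔣 b

/-- **Period matrix**: there is a continuous real-linear isomorphism `Φ : ℝ^{2q} ≃ ℂ^ι`
(`2q = dim_ℝ ℂ^ι`) with `Φ(ℤ^{2q}) = Λ` — the period group is a FULL LATTICE of `ℂ^ι`, and `ℂ^ι / Λ` is a
complex torus of dimension `q = h^{1,0}(X)`, the Albanese torus of `X`.
[cite: GriffithsHarris1978, Ch. 2 §6] [cite: NeukirchANT1999, Ch. I §4 Prop. (4.2)] -/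
theorem exists_periodMatrix [Fintype ι] :
    ∃ Φ : (Fin (Module.finrank ℝ (ι → ℂ)) → ℝ) ≃L[ℝ] (ι → ℂ),
      ∀ x : ι → ℂ, x ∈ D.periodLattice A 𝔣 b ↔
        ∃ v : Fin (Module.finrank ℝ (ι → ℂ)) → ℤ, Φ (fun i ↦ (v i : ℝ)) = x := by
  have hfg : (D.periodLattice A 𝔣 b).FG :=
    (AddGroup.fg_iff_addSubgroup_fg _).1 (D.fg_periodLattice A 𝔣 b)
  exact AddSubgroup.exists_continuousLinearEquiv_of_fg_of_finrank_le _ hfg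
    (D.finrank_periodLattice_le_finrank_real A 𝔣 b) (D.span_real_periodLattice_eq_top A 𝔣 b)

end UnitaryBallUniformisationDatum

end Literature.AlgebraicGeometry.ShimuraVarieties

end
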